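import Mathlib
import Literature.NumberTheory.LFunctions.Zhang2022.Section12Top1225ExCoreRel
import Literature.NumberTheory.LFunctions.Zhang2022.Section12Top1225Int
import Literature.NumberTheory.LFunctions.Zhang2022.Section9SharpApplications
import Literature.NumberTheory.LFunctions.Zhang2022.Section12RelEdges
import HarnessLib

/-!
# Zhang (2022) §12 (12.13), exact reading: the top range of `S_j(𝐚₁₂,𝐚₂₅)` — the closer
# `Top1225Ex c′` from the relative Lemma 12.3 (`Lemma123FormRel`, hence from `U030Rel`)

Topic `Literature/NumberTheory/LFunctions/Zhang2022` (Landau–Siegel audit tree; verdict-neutral).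
Y. Zhang, *Discrete mean estimates and the Landau–Siegel zero*, arXiv:2211.02515v1 (2022)
[Zhang2022LandauSiegel] — **an unrefereed manuscript under adjudication; theorem-only file, nothing here
bears on its Theorems 1–2 or on Landau–Siegel zeros** (lane ZHANG-L, WP12, seat zl-w12-p6; node
`Typed.Sec12C.Top1225Ex` = binder `hTop1225` of the whole-DAG skeleton, RT-02). p. 71, tex L3614–L3624:
"By Lemma 8.2, 8.3 and 12.3, we find that the sum over `P″₁ < dr < P₂` is equal to … `+ o(α)`".

`top1225Ex_of_lemma123FormRel` assembles the chain of record (W12-R1):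
`S_j(𝐚₁₂,𝐚₂₅)|_{P″₁<dr<P₂}` →[`Top1225.core_topRel`: Lemma 8.2 twice (`Section9Discharge.step9u002_sharp` ⇐
`lemma82_holds`, `Section8FrontEnd82.step8u041_holds`) and the relative ε-free Lemma 12.3 pointwise]
gathered main term →[`Top1225.gathered_eval_top`: (8.10) + the §8 evaluation rule
`Section8RangeEngine.weighted_sum_integral_eval`] `𝔞(∫F₆dt/t + ∫F₇dt/t)` →[`Top1225.top_integrals_sub_intEx`:
`t = Pᶻ`] `main1213intEx`, each step `≤ εα/3` for large `D`. Corollaries: `top1225Ex_of_u030Rel`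
(`Sec12B.lemma123FormRel_of_u030Rel`) and `top1225Ex_of_u030` (absolute `U030`). The remaining input
`U030Rel c′` (Lemma 8.3-continuation on `|s| = 5α`, p. 70) is an OPEN claim of the lane; this file does
not assert it.

## References

* Y. Zhang, arXiv:2211.02515v1 (2022), §12 (12.13) p. 71, tex L3614–L3624; Lemma 12.3 pp. 70–71;
  Lemma 8.2 p. 45; (8.10)–(8.11) pp. 47–48. [cite: Zhang2022LandauSiegel, §12 (12.13) p. 71]
-/

noncomputable section

open Complex Real ComplexConjugate

namespace Literature.NumberTheory.LFunctions.Zhang2022.Typed.Sec12C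

open Literature.NumberTheory.LFunctions.Zhang2022.Skeleton
open Literature.NumberTheory.LFunctions.Zhang2022.Typed.Sec10C.Ranges1422 (alpha_facts)

/-- Three-step triangle inequality. [cite: Zhang2022LandauSiegel, §12 (12.13) p. 71] -/
private theorem norm_sub_le_three {a b c d : ℂ} {x y z : ℝ} (h1 : ‖a - b‖ ≤ x) (h2 : ‖b - c‖ ≤ y)
    (h3 : ‖c - d‖ ≤ z) : ‖a - d‖ ≤ x + y + z :=
  calc ‖a - d‖ ≤ ‖a - b‖ + ‖b - d‖ := norm_sub_le_norm_sub_add_norm_sub _ _ _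
    _ ≤ ‖a - b‖ + (‖b - c‖ + ‖c - d‖) := by gcongr; exact norm_sub_le_norm_sub_add_norm_sub _ _ _
    _ ≤ x + (y + z) := add_le_add h1 (add_le_add h2 h3)
    _ = x + y + z := by ring

/-- `B ≤ 𝓛` for all large `D`. [cite: Zhang2022LandauSiegel, §2 p. 4] -/
private theorem forAllLarge_ell_ge (B : ℝ) : ForAllLarge fun D _ _ => B ≤ ell D := by
  refine ⟨⌈Real.exp B⌉₊, fun D _ χ hD _ _ => ?_⟩
  have hexp : Real.exp B ≤ D := le_trans (Nat.le_ceil _) (by exact_mod_cast hD)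
  show B ≤ Real.log D
  exact (Real.le_log_iff_exp_le (lt_of_lt_of_le (Real.exp_pos _) hexp)).mpr hexp

/-- `A·𝓛ᵃ/𝓛ᵇ ≤ (ε/3)α` once `3|A|/(επ) + 1 ≤ 𝓛` and `b = a + 12` (`α = π/𝓛⁹`, `𝓛 ≤ 𝓛³`).
[cite: Zhang2022LandauSiegel, §2 (2.6)] -/
private theorem small_third {A L ε : ℝ} (a : ℕ) (hε : 0 < ε) (hL1 : 1 ≤ L)
    (hL : 3 * |A| / (ε * π) + 1 ≤ L) : A * L ^ a / L ^ (a + 12) ≤ ε / 3 * (π / L ^ 9) := by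
  have hL0 : 0 < L := by linarith
  have hεπ : 0 < ε * π := by positivity
  have h3 : 3 * |A| ≤ ε * π * L ^ 3 := by
    have h1 : 3 * |A| / (ε * π) ≤ L := by linarith
    rw [div_le_iff₀ hεπ] at h1
    calc 3 * |A| ≤ L * (ε * π) := h1
      _ ≤ L ^ 3 * (ε * π) := by gcongr; exact le_self_pow₀ hL1 three_ne_zero
      _ = ε * π * L ^ 3 := by ring
  have e : A * L ^ a / L ^ (a + 12) = A / L ^ 12 := by
    rw [pow_add, ← div_div, mul_div_cancel_right₀ A (by positivity)]
  rw [e, div_le_iff₀ (by positivity)]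
  calc A ≤ |A| := le_abs_self A
    _ ≤ ε * π * L ^ 3 / 3 := by linarith
    _ = ε / 3 * (π / L ^ 9) * L ^ 12 := by field_simp

/-- **`Z22:(12.13)` in the exact reading, node `Top1225Ex`, from the relative Lemma 12.3.** For `c′ ≥ 0`:
`Sec12B.Lemma123FormRel c′ → Top1225Ex c′` — for every `ε > 0`, all large `D`, real primitive `χ` under
(A), `𝐚₂₅ = (χϰ₁₃)‾`, `j = 1, 2, 3`: `‖S_j(𝐚₁₂,𝐚₂₅)|_{P″₁<dr<P₂} − main1213intEx_j‖ ≤ εα`.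
[cite: Zhang2022LandauSiegel, §12 (12.13) p. 71, tex L3614–L3624] -/
theorem top1225Ex_of_lemma123FormRel (c' : ℝ) (hc' : 0 ≤ c') (h123 : Sec12B.Lemma123FormRel c') :
    Top1225Ex c' := by
  intro ε hε
  -- the constants of the three layers
  obtain ⟨W₀, hW₀⟩ : ∃ W : ℝ,
      W = 1 + 3 * (3 * π * (1 + 5 * |c'| * π)) + 2 * (3 * π * (1 + 5 * |c'| * π)) ^ 2 := ⟨_, rfl⟩
  obtain ⟨Kw, hKw⟩ : ∃ K : ℝ, K = 3 * (1 + 5 * |c'| * π) *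
      (4 + 6 * (3 * π * (1 + 5 * |c'| * π)) + 2 * (3 * π * (1 + 5 * |c'| * π)) ^ 2) := ⟨_, rfl⟩
  obtain ⟨M, hM⟩ : ∃ M : ℝ, M = 74 * (29 * W₀) + 74 * (94 * W₀ + 29 * Kw) * π := ⟨_, rfl⟩
  obtain ⟨KI, hKI⟩ : ∃ K : ℝ, K = 16 * Real.exp 9 * W₀ *
      (5 * (29 * 521 + 0.01 * π ^ 2 * |c'|) + 11.5 * (940 * π + 29 * 531 + 0.02 * π ^ 2 * |c'|) + 6) :=
    ⟨_, rfl⟩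
  have hW₀0 : 0 ≤ W₀ := by rw [hW₀]; positivity
  have hKw0 : 0 ≤ Kw := by rw [hKw]; positivity
  have hM0 : 0 ≤ M := by rw [hM]; positivity
  -- the inputs
  obtain ⟨C92, h92⟩ := Section9Discharge.step9u002_sharp c' (lemma82_holds hc')
  obtain ⟨C41, h41⟩ := Section8FrontEnd82.step8u041_holds hc'
  obtain ⟨C23, h23⟩ := h123
  obtain ⟨CE, hE⟩ := Section8RangeEngine.weighted_sum_integral_eval c'
  set C₁ : ℝ := |C92| + |C41| + |C23| with hC₁
  have hC₁0 : 0 ≤ C₁ := by positivity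
  have hC92 : C92 ≤ C₁ := by rw [hC₁]; linarith [le_abs_self C92, abs_nonneg C41, abs_nonneg C23]
  have hC41 : C41 ≤ C₁ := by rw [hC₁]; linarith [le_abs_self C41, abs_nonneg C92, abs_nonneg C23]
  have hC23 : C23 ≤ C₁ := by rw [hC₁]; linarith [le_abs_self C23, abs_nonneg C92, abs_nonneg C41]
  obtain ⟨K, hK0, hcore⟩ := Top1225.core_topRel c' hC₁0
  -- the threshold
  have hεπ : 0 < ε * π / 3 := by positivity
  set B : ℝ := K ^ 10 / (ε * π / 3) ^ 10 + (3 * |4 * CE * M| / (ε * π) + 1) + (3 * |KI| / (ε * π) + 1)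
    with hB
  refine ((((h92.and h41).and h23).and hE).and
    ((Sec10C.forAllLarge_five_c c').and (forAllLarge_ell_ge B))).mono ?_
  rintro D _ χ hq hp ⟨⟨⟨⟨H92, H41⟩, H23⟩, HE⟩, ⟨-, hℓ6, hc5⟩, hBℓ⟩ hA a25 ha25 j hj
  have hℓ5 : 5 ≤ ell D := by linarith
  have hℓ3 : 3 ≤ ell D := by linarith
  have hℓ1 : 1 ≤ ell D := by linarith
  have hℓ0 : 0 < ell D := by linarith
  have hlog3 : 3 ≤ Real.log D := hℓ3
  obtain ⟨hα, hαeq, -⟩ := alpha_facts (D := D) hℓ3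
  have h15 : ∀ {C : ℝ}, C ≤ C₁ → C * (ell D ^ 15)⁻¹ ≤ C₁ / ell D ^ 15 := by
    intro C hC; rw [div_eq_mul_inv]; exact mul_le_mul_of_nonneg_right hC (by positivity)
  -- Step 1: the core (Lemma 8.2 twice + relative Lemma 12.3)
  have G := hcore hq hp hℓ5 j a25 ha25
    (fun d r hd hr hlt => (H92 hA j hj d r hd hr hlt).trans (h15 hC92))
    (fun d r hd hr hlt => (H41 hA j hj d r hd hr hlt).trans (h15 hC41))
    (fun d r hd hr hlo hhi => by
      rw [Top1225.nsum25_eq_sum122 c' χ hlog3 j hd hr, frakwEx_natCast, mul_neg, sub_neg_eq_add]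
      refine (H23 hA j hj d r hd hr hlo hhi).trans ?_
      exact mul_le_mul_of_nonneg_right (h15 hC23) (by positivity))
  -- Step 2: (8.10) and the evaluation rule
  have S := Top1225.gathered_eval_top c' hq hℓ5 hc5 j (CE := CE) (HE j hj)
  rw [← hW₀, ← hKw, ← hM] at S
  -- Step 3: t = Pᶻ
  have I := Top1225.top_integrals_sub_intEx c' hq hp hℓ5 hc5 hj
  rw [← hW₀, ← hKI] at I
  refine (norm_sub_le_three G S I).trans ?_
  -- Step 4: each term is at most `εα/3`
  have hB1 : K ^ 10 / (ε * π / 3) ^ 10 ≤ ell D := by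
    have : 0 ≤ (3 * |4 * CE * M| / (ε * π) + 1) + (3 * |KI| / (ε * π) + 1) := by positivity
    linarith
  have hB2 : 3 * |4 * CE * M| / (ε * π) + 1 ≤ ell D := by
    have : 0 ≤ K ^ 10 / (ε * π / 3) ^ 10 := by positivity
    have : 0 ≤ 3 * |KI| / (ε * π) + 1 := by positivity
    linarith
  have hB3 : 3 * |KI| / (ε * π) + 1 ≤ ell D := by
    have : 0 ≤ K ^ 10 / (ε * π / 3) ^ 10 := by positivity
    have : 0 ≤ 3 * |4 * CE * M| / (ε * π) + 1 := by positivity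
    linarith
  have t1 : K * (ell D ^ (1.1 : ℝ)) ^ 7 / ell D ^ 17 ≤ ε / 3 * alpha D := by
    have h := Section8FrontEnd44Reduction.final_small hεπ hℓ1 hB1
    rw [hαeq]
    calc K * (ell D ^ (1.1 : ℝ)) ^ 7 / ell D ^ 17 ≤ ε * π / 3 / ell D ^ 9 := h
      _ = ε / 3 * (π / ell D ^ 9) := by ring
  have t2 : 4 * CE * M / ell D ^ 12 ≤ ε / 3 * alpha D := by
    have h := small_third (A := 4 * CE * M) 0 hε hℓ1 hB2
    rw [hαeq]
    simpa using h
  have t3 : KI * ell D ^ 6 / ell D ^ 18 ≤ ε / 3 * alpha D := by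
    rw [hαeq]
    exact small_third (A := KI) 6 hε hℓ1 hB3
  linarith

/-- **Node `Top1225Ex` from the relative `u030`** (`Sec12B.U030Rel`, the Lemma 8.3-continuation on
`|s| = 5α` with error `C𝓛⁻¹⁵Π̂(dr)²`): `0 ≤ c′ → U030Rel c′ → Top1225Ex c′`.
[cite: Zhang2022LandauSiegel, §12 (12.13) p. 71; Lemma 12.3 pp. 70–71] -/
theorem top1225Ex_of_u030Rel (c' : ℝ) (hc' : 0 ≤ c') (h30 : Sec12B.U030Rel c') : Top1225Ex c' :=
  top1225Ex_of_lemma123FormRel c' hc' (Sec12B.lemma123FormRel_of_u030Rel c' h30)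

/-- **Node `Top1225Ex` from the absolute `u030`** (`Sec12B.U030`): `0 ≤ c′ → U030 c′ → Top1225Ex c′`.
[cite: Zhang2022LandauSiegel, §12 (12.13) p. 71; Lemma 12.3 pp. 70–71] -/
theorem top1225Ex_of_u030 (c' : ℝ) (hc' : 0 ≤ c') (h30 : Sec12B.U030 c') : Top1225Ex c' :=
  top1225Ex_of_lemma123FormRel c' hc' (Sec12B.lemma123FormRel_of_u030 c' h30)

end Literature.NumberTheory.LFunctions.Zhang2022.Typed.Sec12C
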